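import Summits.AtomisticToContinuum.BoseEinsteinCondensation.Theorems.BECGroundStateSOSPeriodicIRBoundDefs
import Summits.AtomisticToContinuum.BoseEinsteinCondensation.Theorems.BECGroundStateSOSPeriodicIRBoundWFDefs
import Literature.MathematicalPhysics.QuantumManyBody.PeriodicConfigFourier
import Literature.MathematicalPhysics.QuantumManyBody.CouplingPathSliceFloor
import Literature.MathematicalPhysics.QuantumManyBody.OneBodyCurrentGain
import Mathlib.MeasureTheory.Integral.Bochner.ContinuousLinearMap
import Mathlib.Algebra.QuadraticDiscriminant
import HarnessLib

/-! # Crux `PeriodicIRBound` (stmt-AtomisticToContinuum-3972), line `linear-ph-floor-wagner`, stub 5b `stub_wagnerFeynman` — Polar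
C1–C2: polarisation of the energy form along real lines and the near-minimiser cross-term bound `|Re B(f,g) − E₀ Re⟨f,g⟩| ≤ √δ √𝓔[g]`. -/

/-!
# cross-term bound

(crux stmt-AtomisticToContinuum-3972):

* `qform_add_smul` (C1): `𝓔_w[f + t g] = 𝓔_w[f] + 2t Re B_w(f,g) + t² 𝓔_w[g]` (real `t`) for cores `f, g`
  with finite forms, as an identity of real numbers;
* `normSq_add_smul` (C1'): `‖f + t g‖² = ‖f‖² + 2t Re⟨f,g⟩ + t² ‖g‖²` for continuous `f, g`;
* `abs_formRe_sub_le` (C2): if `𝓔_w[f] ≤ E₀ ‖f‖² + δ` then `|Re B_w(f,g) − E₀ Re⟨f,g⟩| ≤ √δ √𝓔_w[g]`: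
  the variational principle `E₀ ‖f + t g‖² ≤ 𝓔_w[f + t g]` (the tree's
  `periodicGroundStateEnergy_mul_normSq_le`, `CouplingPathSliceFloor.lean`) expanded by C1/C1' is a
  nonnegative real quadratic in `t`, whose discriminant is nonpositive (`discrim_le_zero`).

Toolkit (public): the potential part `potForm w L h = ∫ W|h|²`, `qform = ofReal (cellKineticEnergy) + potForm`
(`qform_eq_kinetic_add_potPart`), its real Bochner form (`integral_potReal`), the pointwise polarisation
`norm_add_ofReal_mul_sq`, the kinetic cross density `kinCross` (`kineticDensityReal_add_smul`), finiteness of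
`𝓔_w[f + t g]` (`qform_add_smul_ne_top`), the splitting `formRe = ∫ kinCross + ∫ W Re(f̄ g)` (`formRe_eq_integral_add`).
-/

noncomputable section

open scoped BigOperators ENNReal ComplexConjugate
open Filter MeasureTheory

namespace Summit.AtomisticToContinuum.BoseEinsteinCondensation.Cruxes.PeriodicIRBound.LinearPhFloorWagner.WF

open Literature.MathematicalPhysics.QuantumManyBody.BoseGas

variable {M : ℕ} {L : ℝ}

/-! ## Pointwise algebra and measurability -/

/-- Polarisation of the squared modulus along a real line: `|a + t b|² = |a|² + 2t Re(ā b) + t²|b|²`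
(`a, b ∈ ℂ`, `t ∈ ℝ`). [folklore] -/
theorem norm_add_ofReal_mul_sq (a b : ℂ) (t : ℝ) :
    ‖a + (t : ℂ) * b‖ ^ 2 = ‖a‖ ^ 2 + 2 * t * (conj a * b).re + t ^ 2 * ‖b‖ ^ 2 := by
  simp only [Complex.sq_norm, Complex.normSq_apply, Complex.add_re, Complex.add_im, Complex.mul_re,
    Complex.mul_im, Complex.ofReal_re, Complex.ofReal_im, Complex.conj_re, Complex.conj_im]
  ring

/-- `(‖z‖₊²).toReal = ‖z‖²` (the `ℝ≥0∞` squared modulus read back in `ℝ`). [folklore] -/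
private theorem toReal_coe_nnnorm_sq (z : ℂ) : (((‖z‖₊ : ℝ≥0∞)) ^ 2).toReal = ‖z‖ ^ 2 := by
  rw [coe_nnnorm_sq_eq_ofReal, ENNReal.toReal_ofReal (sq_nonneg _)]

/-- The crude parallelogram bound `|a + b|² ≤ 2|a|² + 2|b|²` in `ℝ≥0∞`. [folklore] -/
theorem coe_nnnorm_add_sq_le (a b : ℂ) :
    ((‖a + b‖₊ : ℝ≥0∞)) ^ 2 ≤ 2 * ((‖a‖₊ : ℝ≥0∞)) ^ 2 + 2 * ((‖b‖₊ : ℝ≥0∞)) ^ 2 := by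
  simp only [coe_nnnorm_sq_eq_ofReal]
  rw [← ENNReal.ofReal_ofNat 2, ← ENNReal.ofReal_mul zero_le_two, ← ENNReal.ofReal_mul zero_le_two,
    ← ENNReal.ofReal_add (by positivity) (by positivity)]
  exact ENNReal.ofReal_le_ofReal
    (by nlinarith [norm_add_le a b, norm_nonneg (a + b), sq_nonneg (‖a‖ - ‖b‖)])

/-- The periodic pair interaction `W = ∑_{i<j} w^per(xᵢ - xⱼ)` of a measurable profile is measurable. [folklore] -/
theorem measurable_periodicInteraction_wf {w : ℝ → ℝ≥0∞} (hw : Measurable w) (L : ℝ) :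
    Measurable fun X : Config M => periodicInteraction w L X := by
  have hper : Measurable (periodizedPotential w L) := by
    show Measurable fun x => ∑' n : Fin 3 → ℤ, w ‖x - latticeVec L n‖
    exact Measurable.tsum fun n => hw.comp (measurable_id.sub_const _).norm
  unfold periodicInteraction
  refine Finset.measurable_sum _ fun i _ => Finset.measurable_sum _ fun j _ => ?_
  exact hper.comp ((measurable_pi_apply i).sub (measurable_pi_apply j))

/-- The potential density `W |h|²` is measurable (measurable `w`, continuous `h`). [folklore] -/
theorem measurable_potDensity {w : ℝ → ℝ≥0∞} (hw : Measurable w) (L : ℝ) {h : Config M → ℂ}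
    (hh : Continuous h) :
    Measurable fun X : Config M => periodicInteraction w L X * ((‖h X‖₊ : ℝ≥0∞)) ^ 2 :=
  (measurable_periodicInteraction_wf hw L).mul (hh.measurable.nnnorm.coe_nnreal_ennreal.pow_const _)

/-- Cores form a real vector space: `f + t g` is a core when `f, g` are. [folklore] -/
theorem isCore_add_smul {f g : Config M → ℂ} (hf : IsCore L f) (hg : IsCore L g) (t : ℝ) :
    IsCore L (fun X => f X + (t : ℂ) * g X) where
  contDiff := hf.contDiff.add (contDiff_const.mul hg.contDiff)
  periodic X i k := by dsimp only; rw [hf.periodic X i k, hg.periodic X i k]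
  symm σ X := by dsimp only; rw [hf.symm σ X, hg.symm σ X]

/-! ## The norm: C1' -/

/-- `‖h‖².toReal = ∫ |h|²` as a real Bochner integral, for continuous `h`. [folklore] -/
theorem toReal_normSq {h : Config M → ℂ} (hh : Continuous h) :
    (normSq L h).toReal = ∫ X in cellN M L, ‖h X‖ ^ 2 := by
  rw [normSq, integral_eq_lintegral_of_nonneg_ae (Eventually.of_forall fun X => sq_nonneg _)
    ((hh.norm.pow 2).aestronglyMeasurable)]
  simp_rw [coe_nnnorm_sq_eq_ofReal]

/-- `Re⟨f, g⟩ = ∫ Re(f̄ g)` for continuous `f, g` (`Re` commutes with the Bochner integral). [folklore] -/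
theorem integral_re_conj_mul {f g : Config M → ℂ} (hf : Continuous f) (hg : Continuous g) :
    ∫ X in cellN M L, (conj (f X) * g X).re = innerRe L f g := by
  have h := integral_re (integrableOn_cellN ((Complex.continuous_conj.comp hf).mul hg) L)
  simp only [RCLike.re_to_complex] at h
  exact h

/-- C1': the same for the norms: `‖f + t g‖² = ‖f‖² + 2t Re⟨f,g⟩ + t²‖g‖²`. -/
theorem normSq_add_smul (hL : 0 < L) {f g : Config M → ℂ} (hf : Continuous f) (hg : Continuous g) (t : ℝ) :
    (normSq L (fun X => f X + (t : ℂ) * g X)).toReal =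
      (normSq L f).toReal + 2 * t * innerRe L f g + t ^ 2 * (normSq L g).toReal := by
  have _ := hL
  rw [toReal_normSq (h := fun X => f X + (t : ℂ) * g X) (by fun_prop), toReal_normSq hf,
    toReal_normSq hg, ← integral_re_conj_mul hf hg]
  simp_rw [norm_add_ofReal_mul_sq]
  have h1 : Integrable (fun X => ‖f X‖ ^ 2) (volume.restrict (cellN M L)) :=
    integrableOn_cellN (hf.norm.pow 2) L
  have h2 : Integrable (fun X => (conj (f X) * g X).re) (volume.restrict (cellN M L)) :=
    integrableOn_cellN (Complex.continuous_re.comp ((Complex.continuous_conj.comp hf).mul hg)) L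
  have h3 : Integrable (fun X => ‖g X‖ ^ 2) (volume.restrict (cellN M L)) :=
    integrableOn_cellN (hg.norm.pow 2) L
  rw [integral_add (h1.fun_add (h2.const_mul _)) (h3.const_mul _), integral_add h1 (h2.const_mul _),
    integral_const_mul, integral_const_mul]

/-! ## The potential part of the form -/

/-- `𝓔_w[h] = T(h) + P_w(h)` with the real kinetic energy `T(h) = cellKineticEnergy L h`, for `C¹ h`. [folklore] -/
theorem qform_eq_kinetic_add_potPart (w : ℝ → ℝ≥0∞) (L : ℝ) {h : Config M → ℂ} (hh : ContDiff ℝ 1 h) :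
    qform w L h = ENNReal.ofReal (cellKineticEnergy L h) + potForm w L h := by
  rw [← lintegral_kineticDensity_eq hh L]
  exact lintegral_add_left (measurable_kineticDensity hh) _

/-- `𝓔_w[h].toReal = T(h) + P_w(h).toReal` when `P_w(h) < ∞` (`C¹ h`). [folklore] -/
theorem toReal_qform (w : ℝ → ℝ≥0∞) (L : ℝ) {h : Config M → ℂ} (hh : ContDiff ℝ 1 h)
    (hP : potForm w L h ≠ ⊤) :
    (qform w L h).toReal = cellKineticEnergy L h + (potForm w L h).toReal := by
  rw [qform_eq_kinetic_add_potPart w L hh, ENNReal.toReal_add ENNReal.ofReal_ne_top hP,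
    ENNReal.toReal_ofReal (cellKineticEnergy_nonneg L h)]

/-- The real potential density `W.toReal |h|²` is integrable on the cell when `P_w(h) < ∞`. [folklore] -/
theorem integrable_potReal {w : ℝ → ℝ≥0∞} (hw : Measurable w) {h : Config M → ℂ} (hh : Continuous h)
    (hP : potForm w L h ≠ ⊤) :
    Integrable (fun X => (periodicInteraction w L X).toReal * ‖h X‖ ^ 2) (volume.restrict (cellN M L)) := by
  refine (integrable_toReal_of_lintegral_ne_top (measurable_potDensity hw L hh).aemeasurable hP).congr
    (Eventually.of_forall fun X => ?_)
  simp only [ENNReal.toReal_mul, toReal_coe_nnnorm_sq]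

/-- `∫ W.toReal |h|² = P_w(h).toReal` when `P_w(h) < ∞` (then `W|h|² < ∞` a.e.). [folklore] -/
theorem integral_potReal {w : ℝ → ℝ≥0∞} (hw : Measurable w) {h : Config M → ℂ} (hh : Continuous h)
    (hP : potForm w L h ≠ ⊤) :
    ∫ X in cellN M L, (periodicInteraction w L X).toReal * ‖h X‖ ^ 2 = (potForm w L h).toReal := by
  rw [potForm, ← integral_toReal (measurable_potDensity hw L hh).aemeasurable
    (ae_lt_top (measurable_potDensity hw L hh) hP)]
  refine integral_congr_ae (Eventually.of_forall fun X => ?_)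
  simp only [ENNReal.toReal_mul, toReal_coe_nnnorm_sq]

/-- `P_w(f + t g) ≤ 2 P_w(f) + 2|t|² P_w(g)`. [folklore] -/
theorem potPart_add_smul_le {w : ℝ → ℝ≥0∞} (hw : Measurable w) {f g : Config M → ℂ} (hf : Continuous f)
    (hg : Continuous g) (t : ℝ) :
    potForm w L (fun X => f X + (t : ℂ) * g X) ≤
      2 * potForm w L f + 2 * ((‖(t : ℂ)‖₊ : ℝ≥0∞)) ^ 2 * potForm w L g := by
  unfold potForm
  rw [← lintegral_const_mul _ (measurable_potDensity hw L hf),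
    ← lintegral_const_mul _ (measurable_potDensity hw L hg),
    ← lintegral_add_left ((measurable_potDensity hw L hf).const_mul _)]
  refine lintegral_mono fun X => ?_
  calc periodicInteraction w L X * ((‖f X + (t : ℂ) * g X‖₊ : ℝ≥0∞)) ^ 2
      ≤ periodicInteraction w L X *
          (2 * ((‖f X‖₊ : ℝ≥0∞)) ^ 2 + 2 * ((‖(t : ℂ) * g X‖₊ : ℝ≥0∞)) ^ 2) := by
        gcongr
        exact coe_nnnorm_add_sq_le _ _
    _ = _ := by
        rw [nnnorm_mul, ENNReal.coe_mul, mul_pow]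
        ring

/-- `P_w(f + t g) < ∞` when `P_w(f), P_w(g) < ∞`. [folklore] -/
theorem potPart_add_smul_ne_top {w : ℝ → ℝ≥0∞} (hw : Measurable w) {f g : Config M → ℂ}
    (hf : Continuous f) (hg : Continuous g) (hPf : potForm w L f ≠ ⊤) (hPg : potForm w L g ≠ ⊤) (t : ℝ) :
    potForm w L (fun X => f X + (t : ℂ) * g X) ≠ ⊤ :=
  ne_top_of_le_ne_top (ENNReal.add_ne_top.2 ⟨ENNReal.mul_ne_top ENNReal.ofNat_ne_top hPf,
    ENNReal.mul_ne_top (ENNReal.mul_ne_top ENNReal.ofNat_ne_top (ENNReal.pow_ne_top ENNReal.coe_ne_top))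
      hPg⟩) (potPart_add_smul_le hw hf hg t)

/-- `𝓔_w[f + t g] < ∞` for `C¹` functions `f, g` with finite forms. [folklore] -/
theorem qform_add_smul_ne_top {w : ℝ → ℝ≥0∞} (hw : Measurable w) {f g : Config M → ℂ}
    (hf : ContDiff ℝ 1 f) (hg : ContDiff ℝ 1 g) (hfE : qform w L f ≠ ⊤) (hgE : qform w L g ≠ ⊤) (t : ℝ) :
    qform w L (fun X => f X + (t : ℂ) * g X) ≠ ⊤ := by
  rw [qform_eq_kinetic_add_potPart w L (hf.add (contDiff_const.mul hg))]
  exact ENNReal.add_ne_top.2 ⟨ENNReal.ofReal_ne_top,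
    potPart_add_smul_ne_top hw hf.continuous hg.continuous
      (ne_top_of_le_ne_top hfE (potForm_le_qform' w L f))
      (ne_top_of_le_ne_top hgE (potForm_le_qform' w L g)) t⟩

/-- The potential cross density `W.toReal Re(f̄ g)` is integrable when `P_w(f), P_w(g) < ∞`
(`|W Re(f̄ g)| ≤ W(|f|² + |g|²)`). [folklore] -/
theorem integrable_potCross {w : ℝ → ℝ≥0∞} (hw : Measurable w) {f g : Config M → ℂ}
    (hf : Continuous f) (hg : Continuous g) (hPf : potForm w L f ≠ ⊤) (hPg : potForm w L g ≠ ⊤) :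
    Integrable (fun X => (periodicInteraction w L X).toReal * (conj (f X) * g X).re)
      (volume.restrict (cellN M L)) := by
  refine ((integrable_potReal hw hf hPf).add (integrable_potReal hw hg hPg)).mono' ?_
    (Eventually.of_forall fun X => ?_)
  · exact ((measurable_periodicInteraction_wf hw L).ennreal_toReal.mul
      (Complex.continuous_re.comp ((Complex.continuous_conj.comp hf).mul hg)).measurable).aestronglyMeasurable
  · rw [Real.norm_eq_abs, abs_mul, abs_of_nonneg ENNReal.toReal_nonneg, Pi.add_apply, ← mul_add]
    refine mul_le_mul_of_nonneg_left ?_ ENNReal.toReal_nonneg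
    calc |(conj (f X) * g X).re| ≤ ‖conj (f X) * g X‖ := Complex.abs_re_le_norm _
      _ = ‖f X‖ * ‖g X‖ := by rw [norm_mul, Complex.norm_conj]
      _ ≤ ‖f X‖ ^ 2 + ‖g X‖ ^ 2 := by
          nlinarith [sq_nonneg (‖f X‖ - ‖g X‖), norm_nonneg (f X), norm_nonneg (g X)]

/-- Polarisation of the potential part: `P_w(f + t g) = P_w(f) + 2t ∫ W Re(f̄ g) + t² P_w(g)` (reals). [folklore] -/
theorem toReal_potPart_add_smul {w : ℝ → ℝ≥0∞} (hw : Measurable w) {f g : Config M → ℂ}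
    (hf : Continuous f) (hg : Continuous g) (hPf : potForm w L f ≠ ⊤) (hPg : potForm w L g ≠ ⊤) (t : ℝ) :
    (potForm w L (fun X => f X + (t : ℂ) * g X)).toReal =
      (potForm w L f).toReal +
        2 * t * (∫ X in cellN M L, (periodicInteraction w L X).toReal * (conj (f X) * g X).re) +
        t ^ 2 * (potForm w L g).toReal := by
  rw [← integral_potReal (h := fun X => f X + (t : ℂ) * g X) hw (by fun_prop)
      (potPart_add_smul_ne_top hw hf hg hPf hPg t),
    ← integral_potReal hw hf hPf, ← integral_potReal hw hg hPg]
  have h1 := integrable_potReal hw hf hPf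
  have h2 := integrable_potCross hw hf hg hPf hPg
  have h3 := integrable_potReal hw hg hPg
  have hpt : ∀ X, (periodicInteraction w L X).toReal * ‖f X + (t : ℂ) * g X‖ ^ 2 =
      (periodicInteraction w L X).toReal * ‖f X‖ ^ 2 +
        2 * t * ((periodicInteraction w L X).toReal * (conj (f X) * g X).re) +
        t ^ 2 * ((periodicInteraction w L X).toReal * ‖g X‖ ^ 2) := fun X => by
    rw [norm_add_ofReal_mul_sq]; ring
  simp_rw [hpt]
  rw [integral_add (h1.fun_add (h2.const_mul _)) (h3.const_mul _), integral_add h1 (h2.const_mul _),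
    integral_const_mul, integral_const_mul]

/-! ## The kinetic part of the form -/

/-- The kinetic cross density of `C¹` functions is continuous. [folklore] -/
theorem continuous_kinCross {f g : Config M → ℂ} (hf : ContDiff ℝ 1 f) (hg : ContDiff ℝ 1 g) :
    Continuous (kinCross f g) := by
  unfold kinCross
  refine continuous_finsetSum _ fun i _ => continuous_finsetSum _ fun c _ => ?_
  exact Complex.continuous_re.comp ((Complex.continuous_conj.comp
    ((hf.continuous_fderiv one_ne_zero).clm_apply continuous_const)).mul
      ((hg.continuous_fderiv one_ne_zero).clm_apply continuous_const))

/-- Pointwise polarisation of the kinetic density: `|∇(f + t g)|² = |∇f|² + 2t Σ Re(∂f̄ ∂g) + t²|∇g|²`. [folklore] -/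
theorem kineticDensityReal_add_smul {f g : Config M → ℂ} (hf : Differentiable ℝ f) (hg : Differentiable ℝ g)
    (t : ℝ) (X : Config M) :
    kineticDensityReal (fun Y => f Y + (t : ℂ) * g Y) X =
      kineticDensityReal f X + 2 * t * kinCross f g X + t ^ 2 * kineticDensityReal g X := by
  have hd : fderiv ℝ (fun Y => f Y + (t : ℂ) * g Y) X = fderiv ℝ f X + (t : ℂ) • fderiv ℝ g X :=
    ((hf X).hasFDerivAt.add ((hg X).hasFDerivAt.const_mul (t : ℂ))).fderiv
  unfold kineticDensityReal kinCross
  simp only [hd, add_apply, smul_apply, smul_eq_mul, norm_add_ofReal_mul_sq, Finset.sum_add_distrib,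
    Finset.mul_sum]

/-- Polarisation of the kinetic energy: `T(f + t g) = T(f) + 2t ∫ kinCross f g + t² T(g)`. [folklore] -/
theorem cellKineticEnergy_add_smul {f g : Config M → ℂ} (hf : ContDiff ℝ 1 f) (hg : ContDiff ℝ 1 g) (t : ℝ) :
    cellKineticEnergy L (fun X => f X + (t : ℂ) * g X) =
      cellKineticEnergy L f + 2 * t * (∫ X in cellN M L, kinCross f g X) + t ^ 2 * cellKineticEnergy L g := by
  unfold cellKineticEnergy
  simp_rw [kineticDensityReal_add_smul (hf.differentiable one_ne_zero) (hg.differentiable one_ne_zero) t]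
  have h1 : Integrable (kineticDensityReal f) (volume.restrict (cellN M L)) :=
    integrableOn_cellN (continuous_kineticDensityReal hf) L
  have h2 : Integrable (kinCross f g) (volume.restrict (cellN M L)) :=
    integrableOn_cellN (continuous_kinCross hf hg) L
  have h3 : Integrable (kineticDensityReal g) (volume.restrict (cellN M L)) :=
    integrableOn_cellN (continuous_kineticDensityReal hg) L
  rw [integral_add (h1.fun_add (h2.const_mul _)) (h3.const_mul _), integral_add h1 (h2.const_mul _),
    integral_const_mul, integral_const_mul]

/-- Splitting of the polarised form: `Re B_w(f,g) = ∫ kinCross f g + ∫ W Re(f̄ g)` when `P_w(f), P_w(g) < ∞`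
(both summands integrable). [folklore] -/
theorem formRe_eq_integral_add {w : ℝ → ℝ≥0∞} (hw : Measurable w) {f g : Config M → ℂ}
    (hf : ContDiff ℝ 1 f) (hg : ContDiff ℝ 1 g) (hPf : potForm w L f ≠ ⊤) (hPg : potForm w L g ≠ ⊤) :
    formRe w L f g = (∫ X in cellN M L, kinCross f g X) +
      ∫ X in cellN M L, (periodicInteraction w L X).toReal * (conj (f X) * g X).re := by
  rw [← integral_add (integrableOn_cellN (continuous_kinCross hf hg) L)
    (integrable_potCross hw hf.continuous hg.continuous hPf hPg)]
  rfl

/-! ## C1 -/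

/-- C1 (polarisation): `𝓔[f + t g] = 𝓔[f] + 2t Re B(f,g) + t² 𝓔[g]` for cores with finite forms (real `t`). -/
theorem qform_add_smul (hL : 0 < L) {w : ℝ → ℝ≥0∞} (hw : Measurable w) {f g : Config M → ℂ}
    (hf : IsCore L f) (hg : IsCore L g) (hfE : qform w L f ≠ ⊤) (hgE : qform w L g ≠ ⊤) (t : ℝ) :
    (qform w L (fun X => f X + (t : ℂ) * g X)).toReal =
      (qform w L f).toReal + 2 * t * formRe w L f g + t ^ 2 * (qform w L g).toReal := by
  have _ := hL
  have hPf : potForm w L f ≠ ⊤ := ne_top_of_le_ne_top hfE (potForm_le_qform' w L f)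
  have hPg : potForm w L g ≠ ⊤ := ne_top_of_le_ne_top hgE (potForm_le_qform' w L g)
  rw [toReal_qform w L (hf.contDiff.add (contDiff_const.mul hg.contDiff))
      (potPart_add_smul_ne_top hw hf.contDiff.continuous hg.contDiff.continuous hPf hPg t),
    toReal_qform w L hf.contDiff hPf, toReal_qform w L hg.contDiff hPg,
    cellKineticEnergy_add_smul hf.contDiff hg.contDiff t,
    toReal_potPart_add_smul hw hf.contDiff.continuous hg.contDiff.continuous hPf hPg t,
    formRe_eq_integral_add hw hf.contDiff hg.contDiff hPf hPg]
  ring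

/-! ## C2 -/

/-- A1 (variational principle, unnormalised; the tree's scaling inequality
`periodicGroundStateEnergy_mul_normSq_le`): `E₀ · ‖f‖² ≤ 𝓔_w[f]` for every core `f`. [folklore] -/
private theorem groundStateEnergy_mul_normSq_le' (w : ℝ → ℝ≥0∞) {f : Config M → ℂ} (hf : IsCore L f) :
    periodicGroundStateEnergy w M L * normSq L f ≤ qform w L f :=
  periodicGroundStateEnergy_mul_normSq_le w hf.contDiff hf.periodic hf.symm

/-- C2 (cross-term bound for near-minimisers): if `𝓔[f] ≤ E₀‖f‖² + δ` (all finite) then for every core `g` with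
finite form, `|Re B(f,g) − E₀ Re⟨f,g⟩| ≤ √δ · √𝓔[g]`, from `𝓔[f + t g] ≥ E₀ ‖f + t g‖²` (A1) expanded by
C1/C1' (a nonnegative real quadratic in `t` has nonpositive discriminant). -/
theorem abs_formRe_sub_le (hL : 0 < L) {w : ℝ → ℝ≥0∞} (hw : Measurable w) {f g : Config M → ℂ}
    (hf : IsCore L f) (hg : IsCore L g) (hfE : qform w L f ≠ ⊤) (hgE : qform w L g ≠ ⊤)
    (hE : periodicGroundStateEnergy w M L ≠ ⊤) {δ : ℝ} (hδ : 0 ≤ δ)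
    (hnear : (qform w L f).toReal ≤ (periodicGroundStateEnergy w M L).toReal * (normSq L f).toReal + δ) :
    |formRe w L f g - (periodicGroundStateEnergy w M L).toReal * innerRe L f g| ≤
      Real.sqrt δ * Real.sqrt ((qform w L g).toReal) := by
  have _ := hE
  have hE0 : 0 ≤ (periodicGroundStateEnergy w M L).toReal := ENNReal.toReal_nonneg
  have hNg : 0 ≤ (normSq L g).toReal := ENNReal.toReal_nonneg
  -- the variational inequality along the real line `f + t g`, expanded
  have key : ∀ t : ℝ, 0 ≤ (qform w L g).toReal * (t * t) +
      2 * (formRe w L f g - (periodicGroundStateEnergy w M L).toReal * innerRe L f g) * t + δ := by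
    intro t
    have hreal : (periodicGroundStateEnergy w M L).toReal *
        (normSq L (fun X => f X + (t : ℂ) * g X)).toReal ≤
          (qform w L (fun X => f X + (t : ℂ) * g X)).toReal := by
      rw [← ENNReal.toReal_mul]
      exact ENNReal.toReal_mono (qform_add_smul_ne_top hw hf.contDiff hg.contDiff hfE hgE t)
        (groundStateEnergy_mul_normSq_le' w (isCore_add_smul hf hg t))
    rw [qform_add_smul hL hw hf hg hfE hgE t,
      normSq_add_smul hL hf.contDiff.continuous hg.contDiff.continuous t] at hreal
    have hEg : 0 ≤ (periodicGroundStateEnergy w M L).toReal * (t ^ 2 * (normSq L g).toReal) :=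
      mul_nonneg hE0 (mul_nonneg (sq_nonneg _) hNg)
    nlinarith [hreal, hnear, hEg]
  have hdisc := discrim_le_zero key
  rw [discrim] at hdisc
  have hsq : (formRe w L f g - (periodicGroundStateEnergy w M L).toReal * innerRe L f g) ^ 2 ≤
      δ * (qform w L g).toReal := by nlinarith [hdisc]
  calc |formRe w L f g - (periodicGroundStateEnergy w M L).toReal * innerRe L f g|
      ≤ Real.sqrt (δ * (qform w L g).toReal) := Real.abs_le_sqrt hsq
    _ = Real.sqrt δ * Real.sqrt ((qform w L g).toReal) := Real.sqrt_mul hδ _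

end Summit.AtomisticToContinuum.BoseEinsteinCondensation.Cruxes.PeriodicIRBound.LinearPhFloorWagner.WF

end

namespace Summit.AtomisticToContinuum.BoseEinsteinCondensation.Cruxes.PeriodicIRBound.LinearPhFloorWagner

/-- The registered sub-goal `stub_wfPolar` of the crux ledger: this file's headline lemma `WF.abs_formRe_sub_le`. -/
theorem stub_wfPolar : WF.Pkg.Polar :=
  @WF.abs_formRe_sub_le

end Summit.AtomisticToContinuum.BoseEinsteinCondensation.Cruxes.PeriodicIRBound.LinearPhFloorWagner
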